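import Mathlib.Analysis.SpecialFunctions.Pow.Real
import Mathlib.Analysis.SpecialFunctions.Integrals.Basic
import Mathlib.Analysis.SumIntegralComparisons
import Mathlib.Analysis.PSeries
import Mathlib.NumberTheory.ArithmeticFunction.Moebius
import Literature.NumberTheory.Sieve.GoldstonPintzYildirimEulerProduct
import HarnessLib

/-!
# Elementary tail, divisor-type and dyadic bounds for the sieve of BTT §5

Topic `Literature/NumberTheory/CubicFields`; theorem-only toolkit (Mathlib, plus the tree's `p`-series tail
`Sieve.GPY.sum_Ioc_rpow_neg_le`; no definition, no named fact) for the bookkeeping of Bhargava–Taniguchi–Thorne 2023, §5 — the estimates written there as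
`E₁ ≪ X Σ_{q>Q} q^{-2+ε} + X^{5/6} Σ_{q>Q} q^{-5/3+ε} ≪ X/Q^{1-ε}`, `E₃ ≪ X Σ_{q>Q} 6^{ω(q)} q^{-2} ≪ X/Q^{1-ε}`,
`E₂ ≪ X^{3/5} Σ_{Q₁} Q₁^{1/5+ε}` over dyadic `Q₁ = 2^j < Q`, and the choice `Q = X^{1/3-ε}`:

* `pow_card_primeFactors_le` — **`A^{ω(n)} ≪_{A,ε} n^ε`** (`A ≥ 1`): the primes `p ≥ A^{1/ε}` each
  contribute `A ≤ p^ε`, the finitely many smaller ones a constant;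
* (`Σ_{M < q ≤ N} q^{-a} ≤ M^{1-a}/(a-1)` for `a > 1` is the tree's `Sieve.GPY.sum_Ioc_rpow_neg_le`);
* `summable_of_abs_le_rpow_neg`, `abs_tsum_sub_sum_range_le` — for `|h(q)| ≤ C q^{-a}` (`a > 1`):
  `h` is summable and `|Σ_q h(q) − Σ_{q<M} h(q)| ≤ C (a/(a-1)) M^{1-a}`;
* `sum_Ico_one_two_pow_eq_sum_range` — the dyadic decomposition `[1, 2^{J+1}) = ⊔_{j ≤ J} [2^j, 2^{j+1})`;
* `sum_range_two_pow_rpow_fifth_le` — `Σ_{j ≤ J} (2^j)^{1/5} ≤ 16 (2^J)^{1/5}`;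
* `exists_two_pow_le_lt` — every real `Y ≥ 1` lies in a dyadic interval `[2^J, 2^{J+1})`.

## References

* M. Bhargava, T. Taniguchi, F. Thorne, *Improved error estimates for the Davenport–Heilbronn
  theorems*, Math. Ann. 389 (2024) = arXiv:2107.12819, §5 (the bounds for `E₁, E₂, E₃` and the
  choice `Q = X^{1/3−ε}`) [BhargavaTaniguchiThorne2023].
-/

noncomputable section

open Finset Real

namespace Literature.NumberTheory.CubicFields

/-! ### `A^{ω(n)} ≪ n^ε` -/

/-- **`A^{ω(n)} ≤ C_{A,ε} · n^ε`** for `A ≥ 1`, `ε > 0` and all `n ≥ 1` (`ω(n) = #n.primeFactors`):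
with `B = ⌈A^{1/ε}⌉`, the prime factors `p ≥ B` satisfy `A ≤ p^ε` and there are at most `B` smaller
ones, so `A^{ω(n)} ≤ A^B ∏_{p ∣ n} p^ε ≤ A^B n^ε`. (The standard `d(n), 2^{ω(n)}, 6^{ω(n)} ≪ n^ε`.) [folklore] -/
theorem pow_card_primeFactors_le {A : ℝ} (hA : 1 ≤ A) {ε : ℝ} (hε : 0 < ε) :
    ∃ C : ℝ, 0 < C ∧ ∀ n : ℕ, n ≠ 0 → A ^ n.primeFactors.card ≤ C * (n : ℝ) ^ ε := by
  have hA0 : 0 < A := one_pos.trans_le hA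
  set B : ℕ := ⌈A ^ (1 / ε)⌉₊ with hB
  refine ⟨A ^ B, pow_pos hA0 B, fun n hn => ?_⟩
  have hsplit : A ^ n.primeFactors.card =
      A ^ (n.primeFactors.filter (fun p => p < B)).card * A ^ (n.primeFactors.filter (fun p => ¬ p < B)).card := by
    rw [← pow_add, Finset.card_filter_add_card_filter_not]
  rw [hsplit]
  have h1 : A ^ (n.primeFactors.filter (fun p => p < B)).card ≤ A ^ B := by
    refine pow_le_pow_right₀ hA ?_
    calc (n.primeFactors.filter (fun p => p < B)).card ≤ (Finset.range B).card :=
          Finset.card_le_card fun p hp => Finset.mem_range.mpr (Finset.mem_filter.mp hp).2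
      _ = B := Finset.card_range B
  have h2 : A ^ (n.primeFactors.filter (fun p => ¬ p < B)).card ≤ (n : ℝ) ^ ε := by
    rw [← Finset.prod_const]
    calc ∏ _p ∈ n.primeFactors.filter (fun p => ¬ p < B), A
        ≤ ∏ p ∈ n.primeFactors.filter (fun p => ¬ p < B), ((p : ℝ)) ^ ε := by
          refine Finset.prod_le_prod (fun _ _ => hA0.le) fun p hp => ?_
          have hpB : (B : ℝ) ≤ p := by exact_mod_cast not_lt.mp (Finset.mem_filter.mp hp).2
          have hAB : A ^ (1 / ε) ≤ (B : ℝ) := Nat.le_ceil _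
          calc A = (A ^ (1 / ε)) ^ ε := by
                rw [← Real.rpow_mul hA0.le, one_div_mul_cancel hε.ne', Real.rpow_one]
            _ ≤ (p : ℝ) ^ ε := Real.rpow_le_rpow (by positivity) (hAB.trans hpB) hε.le
      _ ≤ ∏ p ∈ n.primeFactors, ((p : ℝ)) ^ ε := by
          rw [Finset.prod_filter]
          refine Finset.prod_le_prod (fun p _ => by split_ifs <;> positivity) fun p hp => ?_
          have hp1 : (1 : ℝ) ≤ (p : ℝ) := by exact_mod_cast (Nat.prime_of_mem_primeFactors hp).one_lt.le
          split_ifs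
          · exact Real.one_le_rpow hp1 hε.le
          · exact le_rfl
      _ = (((∏ p ∈ n.primeFactors, p : ℕ)) : ℝ) ^ ε := by
          rw [Nat.cast_prod, ← Real.finsetProd_rpow _ _ fun p _ => by positivity]
      _ ≤ (n : ℝ) ^ ε := by
          refine Real.rpow_le_rpow (by positivity) ?_ hε.le
          exact_mod_cast Nat.le_of_dvd (Nat.pos_of_ne_zero hn) (Nat.prod_primeFactors_dvd n)
  calc A ^ (n.primeFactors.filter (fun p => p < B)).card * A ^ (n.primeFactors.filter (fun p => ¬ p < B)).card
      ≤ A ^ B * (n : ℝ) ^ ε := mul_le_mul h1 h2 (by positivity) (by positivity)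

/-! ### Tails of `p`-series -/

/-- A function with `|h(q)| ≤ C q^{-a}` (`q ≥ 1`, `a > 1`) and `h(0) = 0` is summable. [folklore] -/
theorem summable_of_abs_le_rpow_neg {h : ℕ → ℝ} {C a : ℝ} (ha : 1 < a) (h0 : h 0 = 0)
    (hb : ∀ q : ℕ, 1 ≤ q → |h q| ≤ C * (q : ℝ) ^ (-a)) : Summable h := by
  refine Summable.of_norm_bounded ((Real.summable_nat_rpow.mpr (by linarith : -a < -1)).mul_left C) fun q => ?_
  rw [Real.norm_eq_abs]
  rcases Nat.eq_zero_or_pos q with rfl | hq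
  · rw [h0, abs_zero, Nat.cast_zero, Real.zero_rpow (by linarith), mul_zero]
  · exact hb q hq

/-- `Σ_{i ≥ 0} (i + M)^{-a} ≤ (a/(a-1)) M^{1-a}` for `a > 1`, `M ≥ 1` (the term `i = 0` plus the
tail bound `Sieve.GPY.sum_Ioc_rpow_neg_le`). [folklore] -/
theorem tsum_add_rpow_neg_le {a : ℝ} (ha : 1 < a) {M : ℕ} (hM : 1 ≤ M) :
    Summable (fun i : ℕ => ((i + M : ℕ) : ℝ) ^ (-a)) ∧
      ∑' i : ℕ, ((i + M : ℕ) : ℝ) ^ (-a) ≤ a / (a - 1) * (M : ℝ) ^ (1 - a) := by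
  have hM0 : (0 : ℝ) < M := by exact_mod_cast hM
  have hsum : Summable (fun i : ℕ => ((i + M : ℕ) : ℝ) ^ (-a)) :=
    (summable_nat_add_iff M).mpr (Real.summable_nat_rpow.mpr (by linarith : -a < -1))
  refine ⟨hsum, ?_⟩
  have hbound : ∀ n : ℕ, ∑ i ∈ Finset.range n, ((i + M : ℕ) : ℝ) ^ (-a) ≤ a / (a - 1) * (M : ℝ) ^ (1 - a) := by
    intro n
    have hre : ∑ i ∈ Finset.range n, ((i + M : ℕ) : ℝ) ^ (-a) = ∑ q ∈ Finset.Ico M (M + n), (q : ℝ) ^ (-a) := by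
      rw [Finset.sum_Ico_eq_sum_range, Nat.add_sub_cancel_left]
      exact Finset.sum_congr rfl fun i _ => by rw [Nat.add_comm]
    rw [hre]
    have hsub : Finset.Ico M (M + n) ⊆ insert M (Finset.Ioc M (M + n)) := by
      intro q hq
      rw [Finset.mem_insert, Finset.mem_Ioc]
      rw [Finset.mem_Ico] at hq
      omega
    calc ∑ q ∈ Finset.Ico M (M + n), (q : ℝ) ^ (-a)
        ≤ ∑ q ∈ insert M (Finset.Ioc M (M + n)), (q : ℝ) ^ (-a) :=
          Finset.sum_le_sum_of_subset_of_nonneg hsub fun q _ _ => by positivity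
      _ = (M : ℝ) ^ (-a) + ∑ q ∈ Finset.Ioc M (M + n), (q : ℝ) ^ (-a) :=
          Finset.sum_insert (by simp)
      _ ≤ (M : ℝ) ^ (1 - a) + (M : ℝ) ^ (1 - a) / (a - 1) :=
          add_le_add (Real.rpow_le_rpow_of_exponent_le (by exact_mod_cast hM) (by linarith))
            (Sieve.GPY.sum_Ioc_rpow_neg_le hM ha)
      _ = a / (a - 1) * (M : ℝ) ^ (1 - a) := by
          have ha1 : a - 1 ≠ 0 := by linarith
          field_simp
          ring
  exact tsum_le_of_sum_range_le (fun i => by positivity) hbound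

/-- **Tail of an absolutely convergent sum**: if `|h(q)| ≤ C q^{-a}` for `q ≥ 1` (`a > 1`) and
`h(0) = 0`, then `|Σ_{q ≥ 0} h(q) − Σ_{q < M} h(q)| ≤ C (a/(a-1)) M^{1-a}` for every `M ≥ 1`. [folklore] -/
theorem abs_tsum_sub_sum_range_le {h : ℕ → ℝ} {C a : ℝ} (ha : 1 < a) (hC : 0 ≤ C) (h0 : h 0 = 0)
    (hb : ∀ q : ℕ, 1 ≤ q → |h q| ≤ C * (q : ℝ) ^ (-a)) {M : ℕ} (hM : 1 ≤ M) :
    |∑' q, h q - ∑ q ∈ Finset.range M, h q| ≤ C * (a / (a - 1)) * (M : ℝ) ^ (1 - a) := by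
  have hsum := summable_of_abs_le_rpow_neg ha h0 hb
  obtain ⟨hsumM, htail⟩ := tsum_add_rpow_neg_le ha hM
  rw [← hsum.sum_add_tsum_nat_add M, add_sub_cancel_left]
  have hsum' : Summable fun i => h (i + M) := (summable_nat_add_iff M).mpr hsum
  have hb' : ∀ i : ℕ, ‖h (i + M)‖ ≤ C * ((i + M : ℕ) : ℝ) ^ (-a) := fun i => by
    rw [Real.norm_eq_abs]; exact hb (i + M) (by omega)
  calc |∑' i, h (i + M)| = ‖∑' i, h (i + M)‖ := (Real.norm_eq_abs _).symm
    _ ≤ ∑' i, C * ((i + M : ℕ) : ℝ) ^ (-a) := tsum_of_norm_bounded (hsumM.mul_left C).hasSum hb'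
    _ = C * ∑' i, ((i + M : ℕ) : ℝ) ^ (-a) := tsum_mul_left
    _ ≤ C * (a / (a - 1) * (M : ℝ) ^ (1 - a)) := mul_le_mul_of_nonneg_left htail hC
    _ = C * (a / (a - 1)) * (M : ℝ) ^ (1 - a) := by ring

/-! ### Dyadic decomposition -/

/-- `Σ_{1 ≤ q < 2^{J+1}} F(q) = Σ_{j=0}^{J} Σ_{2^j ≤ q < 2^{j+1}} F(q)`. [folklore] -/
theorem sum_Ico_one_two_pow_eq_sum_range {M : Type*} [AddCommMonoid M] (F : ℕ → M) (J : ℕ) :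
    ∑ q ∈ Finset.Ico 1 (2 ^ (J + 1)), F q = ∑ j ∈ Finset.range (J + 1), ∑ q ∈ Finset.Ico (2 ^ j) (2 ^ (j + 1)), F q := by
  induction J with
  | zero => simp
  | succ J ih =>
    rw [Finset.sum_range_succ, ← ih, Finset.sum_Ico_consecutive _ (Nat.one_le_two_pow) (Nat.pow_le_pow_right two_pos (by omega))]

/-- `9/8 ≤ 2^{1/5}` (as `(9/8)⁵ < 2`). [folklore] -/
theorem nine_div_eight_le_two_rpow_fifth : (9 / 8 : ℝ) ≤ (2 : ℝ) ^ (1 / 5 : ℝ) := by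
  have h : ((9 / 8 : ℝ) ^ (5 : ℕ)) ^ (1 / 5 : ℝ) ≤ (2 : ℝ) ^ (1 / 5 : ℝ) :=
    Real.rpow_le_rpow (by positivity) (by norm_num) (by norm_num)
  rwa [← Real.rpow_natCast, ← Real.rpow_mul (by norm_num), show ((5 : ℕ) : ℝ) * (1 / 5) = 1 by norm_num,
    Real.rpow_one] at h

/-- **`Σ_{j=0}^{J} (2^j)^{1/5} ≤ 16 · (2^J)^{1/5}`** (a geometric sum with ratio `2^{1/5} ≥ 9/8`). [folklore] -/
theorem sum_range_two_pow_rpow_fifth_le (J : ℕ) :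
    ∑ j ∈ Finset.range (J + 1), ((2 : ℝ) ^ j) ^ (1 / 5 : ℝ) ≤ 16 * ((2 : ℝ) ^ J) ^ (1 / 5 : ℝ) := by
  set b : ℝ := (2 : ℝ) ^ (1 / 5 : ℝ) with hb
  have hb98 : (9 / 8 : ℝ) ≤ b := nine_div_eight_le_two_rpow_fifth
  have hb1 : 1 < b := by linarith
  have hb2 : b ≤ 2 := by
    rw [hb]
    calc (2 : ℝ) ^ (1 / 5 : ℝ) ≤ (2 : ℝ) ^ (1 : ℝ) := Real.rpow_le_rpow_of_exponent_le (by norm_num) (by norm_num)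
      _ = 2 := Real.rpow_one 2
  have hpow : ∀ j : ℕ, ((2 : ℝ) ^ j) ^ (1 / 5 : ℝ) = b ^ j := fun j => by
    rw [hb, ← Real.rpow_natCast, ← Real.rpow_mul (by norm_num), ← Real.rpow_natCast, ← Real.rpow_mul (by norm_num),
      mul_comm]
  simp_rw [hpow]
  rw [geom_sum_eq hb1.ne', div_le_iff₀ (by linarith)]
  have hbJ : 0 ≤ b ^ J := by positivity
  calc b ^ (J + 1) - 1 ≤ b ^ (J + 1) := by linarith
    _ = b * b ^ J := by ring
    _ ≤ 2 * b ^ J := by gcongr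
    _ ≤ 16 * b ^ J * (b - 1) := by nlinarith

/-- Every real `Y ≥ 1` lies in a dyadic interval: `2^J ≤ Y < 2^{J+1}` with `J = ⌊log₂ ⌊Y⌋⌋`. [folklore] -/
theorem exists_two_pow_le_lt {Y : ℝ} (hY : 1 ≤ Y) : ∃ J : ℕ, ((2 : ℝ) ^ J) ≤ Y ∧ Y < (2 : ℝ) ^ (J + 1) := by
  set N : ℕ := ⌊Y⌋₊ with hN
  have hN1 : 1 ≤ N := Nat.le_floor (by exact_mod_cast hY)
  refine ⟨Nat.log 2 N, ?_, ?_⟩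
  · calc ((2 : ℝ) ^ Nat.log 2 N) = ((2 ^ Nat.log 2 N : ℕ) : ℝ) := by push_cast; rfl
      _ ≤ N := by exact_mod_cast Nat.pow_log_le_self 2 (by omega)
      _ ≤ Y := Nat.floor_le (by linarith)
  · calc Y < N + 1 := Nat.lt_floor_add_one Y
      _ ≤ ((2 ^ (Nat.log 2 N + 1) : ℕ) : ℝ) := by exact_mod_cast Nat.lt_pow_succ_log_self (by norm_num) N
      _ = (2 : ℝ) ^ (Nat.log 2 N + 1) := by push_cast; rfl

end Literature.NumberTheory.CubicFields

end
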